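import Summits.QuantumFields.GaugeBoot.DiagonalRPTorusGaugeInvariantFour
import Summits.QuantumFields.GaugeBoot.DiagonalRPTorusNegativeTwo
import Summits.QuantumFields.GaugeBoot.DiagonalRPTorusGaugeInvariantNegative
import HarnessLib

/-!
# Diagonal RP on the torus: the character hypothesis is just non-triviality of `ρ`
(gauge-boot, task L3(ζ), rider)

HONEST FRAMING (cell `pub-gaugeboot`, page 1 of every file): the venture produces certified bounds
on lattice expectations at stated coupling, gauge group, dimension and torus size; NOT a mass gap,
NOT a continuum limit, NOT a string tension; NOT Yang–Mills-summit-bearing (barriers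
`FixedCouplingUltralocality`, `PerturbativeInvisibility`). This module only re-expresses a
hypothesis of the structural lemmas L3(δ)/L3(ε)/L3(ζ); it discharges nothing else.

The negative statements `DiagRPTwo.not_diagonalReflectionPositive_two` (L3(δ)),
`DiagRPPolyakov.not_gaugeInvariantDiagonalRP` (L3(ε), `d ≥ 3`),
`DiagRPTwo.not_gaugeInvariantDiagonalRP_two_two` and the classification
`DiagRPTwo.gaugeInvariantDiagonalRP_two_iff` (L3(ζ)) carry the hypothesis "non-constant character",
`∃ g, Re tr ρ g ≠ N`. For a continuous finite-dimensional representation of a compact group this is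
EQUIVALENT to `ρ` being non-trivial, `∃ g, ρ g ≠ 1` (`exists_re_trace_ne_iff`): unitarise
(`CompactGroup.unitarize`, same character); a unitary matrix with `Re tr = N` has every diagonal
entry of real part `1`, hence equal to `1` (entries have norm `≤ 1`), hence is the identity (rows
have norm `1`) — `eq_one_of_mem_unitaryGroup_of_re_diag`, `re_trace_eq_card_iff`. The four
statements are restated with the hypothesis `∃ g, ρ g ≠ 1` (primed names). Folklore linear algebra;
no new mathematics.
-/

open MeasureTheory Complex Finset Function
open scoped ComplexOrder ENNReal

namespace Summit.QuantumFields.GaugeBoot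

open Literature.MathematicalPhysics.QuantumFieldTheory
open Literature.RepresentationTheory.CompactGroups

noncomputable section

namespace DiagRPTwo

/-! ## A unitary matrix with `Re tr = N` is the identity -/

section Unitary

variable {N : ℕ}

/-- A unitary matrix all of whose diagonal entries have real part `1` is the identity. -/
theorem eq_one_of_mem_unitaryGroup_of_re_diag {U : Matrix (Fin N) (Fin N) ℂ}
    (hU : U ∈ Matrix.unitaryGroup (Fin N) ℂ) (h : ∀ a, (U a a).re = 1) : U = 1 := by
  -- diagonal entries: norm ≤ 1 and real part 1 force the entry to be 1
  have hdiag : ∀ a, U a a = 1 := fun a => by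
    have hn : ‖U a a‖ ≤ 1 := entry_norm_bound_of_unitary hU a a
    have hsq : (U a a).re ^ 2 + (U a a).im ^ 2 ≤ 1 := by
      have h1 : ‖U a a‖ ^ 2 ≤ 1 := by nlinarith [norm_nonneg (U a a)]
      rw [← Complex.normSq_eq_norm_sq, Complex.normSq_apply] at h1
      nlinarith [h1]
    have him : (U a a).im = 0 := by
      rw [h a] at hsq
      nlinarith [sq_nonneg (U a a).im]
    exact Complex.ext (by rw [h a]; simp) (by rw [him]; simp)
  -- rows: `Σ_b |U a b|² = 1` from `U Uᴴ = 1`, so the off-diagonal entries vanish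
  have hrow : ∀ a, ∑ b, Complex.normSq (U a b) = 1 := fun a => by
    have h1 := congrFun (congrFun (Matrix.mem_unitaryGroup_iff.1 hU) a) a
    rw [Matrix.mul_apply, Matrix.one_apply_eq] at h1
    have h2 : ∑ b, U a b * star U b a = ∑ b, ((Complex.normSq (U a b) : ℝ) : ℂ) :=
      Finset.sum_congr rfl fun b _ => by
        rw [Matrix.star_apply, Complex.star_def, Complex.mul_conj]
    rw [h2] at h1
    exact_mod_cast h1
  ext a b
  by_cases hab : a = b
  · subst hab; rw [hdiag, Matrix.one_apply_eq]
  · rw [Matrix.one_apply_ne hab]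
    have hs := hrow a
    rw [← Finset.add_sum_erase _ _ (Finset.mem_univ a), hdiag a, map_one] at hs
    have h0 : ∑ x ∈ Finset.univ.erase a, Complex.normSq (U a x) = 0 := by linarith
    have hb : b ∈ Finset.univ.erase a := Finset.mem_erase.2 ⟨Ne.symm hab, Finset.mem_univ b⟩
    exact Complex.normSq_eq_zero.1
      ((Finset.sum_eq_zero_iff_of_nonneg fun x _ => Complex.normSq_nonneg _).1 h0 b hb)

variable {G : Type*} [Group G] [TopologicalSpace G] [IsTopologicalGroup G] [CompactSpace G]
  (ρ : G →* Matrix (Fin N) (Fin N) ℂ)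

/-- **`Re tr ρ(g) = N` iff `ρ(g) = 1`**, for a continuous `N`-dimensional representation of a
compact group (unitarisation). -/
theorem re_trace_eq_card_iff (hρ : Continuous ρ) (g : G) :
    ((ρ g).trace).re = N ↔ ρ g = 1 := by
  refine ⟨fun h => ?_, fun h => by simp [h, Matrix.trace_one]⟩
  have hU := CompactGroup.unitarize_mem_unitaryGroup ρ hρ g
  have hle : ∀ a, (CompactGroup.unitarize ρ hρ g a a).re ≤ 1 := fun a =>
    (Complex.re_le_norm _).trans (CompactGroup.norm_unitarize_apply_le_one ρ hρ g a a)
  have hsum : ∑ a, (CompactGroup.unitarize ρ hρ g a a).re = N := by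
    have := congrArg Complex.re (CompactGroup.trace_unitarize ρ hρ g)
    rw [h, Matrix.trace] at this
    simpa only [Matrix.diag_apply, Complex.re_sum] using this
  have hdiag : ∀ a, (CompactGroup.unitarize ρ hρ g a a).re = 1 := by
    by_contra hne
    push Not at hne
    obtain ⟨a, ha⟩ := hne
    have hlt := Finset.sum_lt_sum (s := Finset.univ) (fun b _ => hle b)
      ⟨a, Finset.mem_univ _, lt_of_le_of_ne (hle a) ha⟩
    rw [hsum, Finset.sum_const, Finset.card_univ, Fintype.card_fin, nsmul_eq_mul, mul_one] at hlt
    exact lt_irrefl _ hlt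
  have hσ : CompactGroup.unitarize ρ hρ g = 1 := eq_one_of_mem_unitaryGroup_of_re_diag hU hdiag
  have hdet := CompactGroup.isUnit_det_unitarizer ρ hρ
  rw [CompactGroup.unitarize_apply] at hσ
  -- `B ρ(g) B⁻¹ = 1` ⇒ `ρ(g) = B⁻¹ B = 1`
  calc ρ g = (CompactGroup.unitarizer ρ hρ)⁻¹ *
        (CompactGroup.unitarizer ρ hρ * ρ g * (CompactGroup.unitarizer ρ hρ)⁻¹) *
        CompactGroup.unitarizer ρ hρ := by
        rw [Matrix.mul_assoc _ (ρ g), ← Matrix.mul_assoc _ (CompactGroup.unitarizer ρ hρ),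
          Matrix.nonsing_inv_mul _ hdet, Matrix.one_mul, Matrix.mul_assoc,
          Matrix.nonsing_inv_mul _ hdet, Matrix.mul_one]
    _ = 1 := by rw [hσ, Matrix.mul_one, Matrix.nonsing_inv_mul _ hdet]

/-- **Non-constant character iff non-trivial representation.** -/
theorem exists_re_trace_ne_iff (hρ : Continuous ρ) :
    (∃ g, ((ρ g).trace).re ≠ N) ↔ ∃ g, ρ g ≠ 1 :=
  exists_congr fun g => not_congr (re_trace_eq_card_iff ρ hρ g)

end Unitary

/-! ## The structural lemmas with the hypothesis `∃ g, ρ g ≠ 1` -/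

section Restated

variable {L N : ℕ} [NeZero L] {G : Type*} [Group G] [TopologicalSpace G] [IsTopologicalGroup G]
  [CompactSpace G] [MeasurableSpace G] [BorelSpace G] [SecondCountableTopology G] [T2Space G]
  (ρ : G →* Matrix (Fin N) (Fin N) ℂ)

/-- L3(δ) restated: closed-half diagonal RP FAILS on `(ℤ/L)²`, `L ≥ 4` even, `β ≠ 0`, for every
non-trivial continuous `ρ`. -/
theorem not_diagonalReflectionPositive_two' (hL : Even L) (h4 : 4 ≤ L) (hρ : Continuous ρ)
    (hρ1 : ∃ g, ρ g ≠ 1) {β : ℝ} (hβ : β ≠ 0) {i j : Fin 2} (hij : i ≠ j) :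
    ¬ DiagonalReflectionPositive (d := 2) (L := L) ρ β i j :=
  not_diagonalReflectionPositive_two ρ hL h4 hρ ((exists_re_trace_ne_iff ρ hρ).2 hρ1) hβ hij

omit [NeZero L] in
/-- L3(ζ) restated: on the `2 × 2` torus the gauge-invariant statement FAILS at every real `β`
for every non-trivial continuous `ρ`. -/
theorem not_gaugeInvariantDiagonalRP_two_two' (hρ : Continuous ρ) (hρ1 : ∃ g, ρ g ≠ 1) (β : ℝ)
    {i j : Fin 2} (hij : i ≠ j) : ¬ GaugeInvariantDiagonalRP (d := 2) (L := 2) ρ β i j :=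
  not_gaugeInvariantDiagonalRP_two_two ρ hρ ((exists_re_trace_ne_iff ρ hρ).2 hρ1) β hij

/-- **L3(ζ) classification, restated**: on the even torus `(ℤ/L)²`, `L ≥ 2`, `β ≥ 0`, for every
NON-TRIVIAL continuous representation `ρ` of a compact metrisable group:
`GaugeInvariantDiagonalRP ρ β i j ↔ 4 ≤ L`. -/
theorem gaugeInvariantDiagonalRP_two_iff' (hL : Even L) (h2 : 2 ≤ L) (hρ : Continuous ρ)
    (hρ1 : ∃ g, ρ g ≠ 1) {β : ℝ} (hβ : 0 ≤ β) {i j : Fin 2} (hij : i ≠ j) :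
    GaugeInvariantDiagonalRP (d := 2) (L := L) ρ β i j ↔ 4 ≤ L :=
  gaugeInvariantDiagonalRP_two_iff ρ hL h2 hρ ((exists_re_trace_ne_iff ρ hρ).2 hρ1) hβ hij

end Restated

end DiagRPTwo

namespace DiagRPPolyakov

variable {d L N : ℕ} [NeZero L] {G : Type*} [Group G] [TopologicalSpace G] [IsTopologicalGroup G]
  [CompactSpace G] [MeasurableSpace G] [BorelSpace G] [SecondCountableTopology G] [T2Space G]
  (ρ : G →* Matrix (Fin N) (Fin N) ℂ)

/-- L3(ε)'s `d ≥ 3` complement restated: `¬ GaugeInvariantDiagonalRP` on `(ℤ/L)^d` with a third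
direction `m ∉ {i, j}`, `L` even `≥ 2`, every real `β`, every non-trivial continuous `ρ`. -/
theorem not_gaugeInvariantDiagonalRP' (hL : Even L) (h2 : 2 ≤ L) (hρ : Continuous ρ)
    (hρ1 : ∃ g, ρ g ≠ 1) (β : ℝ) {i j m : Fin d} (hij : i ≠ j) (hmi : m ≠ i) (hmj : m ≠ j) :
    ¬ GaugeInvariantDiagonalRP (d := d) (L := L) ρ β i j :=
  not_gaugeInvariantDiagonalRP ρ hL h2 hρ ((DiagRPTwo.exists_re_trace_ne_iff ρ hρ).2 hρ1) β hij
    hmi hmj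

end DiagRPPolyakov

end

end Summit.QuantumFields.GaugeBoot
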